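import Mathlib
import HarnessLib
import Summits.NavierStokesRegularity.NavierStokesRegularity.Theorems.LocalSineTubeDoorProfileAlignedWindowRigidityAncient
import Summits.NavierStokesRegularity.NavierStokesRegularity.Theorems.PoloidalWindowDoorPoloidalWindowRigidityWindow

/-!
# Door S11 `LocalTubeDoorHelicity`, crux K2⁗ `FrobeniusProfileRigidity` (stmt-NavierStokesRegularity-19975) — the
# helicity density of a profile is JOINTLY real-analytic on the slab: vanishing on ANY nonempty open space-time set
# (or on any time segment) spreads to every slice

Cell ns-regularity-ideate, stub-worker `ns-helicity-19975-w1` under the K2⁗ lead nsreg-p6 (lands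
`--supports stmt-NavierStokesRegularity-19975 --as helper`; no claim).  The tree's window → slab lemma for the
helicity density (`…FrobeniusWindowRigidityWindow.helicityWindowToSlab`) needs a window on EVERY slice; here the
hypothesis of the crux is shown to propagate from a single nonempty open subset of the open slab `(−∞,0) × ℝ³`:

* `fderiv_slice_eq_comp` — chain rule: the slice derivative is the joint derivative precomposed with `y ↦ (0, y)`,
  `D(v t)(y) = D(uncurry v)(t, y) ∘ ι`;
* `analyticOnNhd_fderiv_slice_uncurry`, `analyticOnNhd_curl_uncurry`, `analyticOnNhd_helicity_uncurry` — for an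
  Oseen-ancient field (continuity, boundedness below every `−δ`, unit-viscosity Oseen–Duhamel identity) the slice
  derivative `(t, y) ↦ D(v t)(y)`, the vorticity `(t, y) ↦ curl v(t)(y)` and the helicity density
  `(t, y) ↦ ⟪v(t,y), curl v(t)(y)⟫` are JOINTLY real-analytic on the open slab (joint analyticity of the field,
  `analyticOnNhd_uncurry`, is the tree's; `curl = curlCLM ∘ D`);
* `helicityOpenSetToSlab` — **if the helicity density vanishes on a nonempty open subset of the slab, it vanishes on
  every slice `s < 0`** (identity theorem on the connected slab);
* `helicityTimeSegmentToSlab` — in particular helicity-free on a time segment `(s₁, s₂)`, `s₂ ≤ 0`, ⇒ helicity-free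
  on the slab: the hypothesis of K2⁗ may be imposed in the far past only, or near the apex only.

So every statement about the helicity-free Type-I class (the crux, the registered stub, Liouville(𝔉) — tree
`…SliceLiouville.sliceQuadrichotomy_iff_frobeniusLiouville`) is equivalent to its version with the helicity
hypothesis on an arbitrary nonempty open space-time set (`frobeniusLiouville_iff_openSet`).

WHAT THIS IS NOT: not a claim about Navier–Stokes regularity, not K2⁗ — analytic-continuation bookkeeping for the
crux's hypothesis (bears_on LADDER-NS N0, door S11 support).
-/

noncomputable section

-- the summit and its single sub-problem share the name (CONVENTIONS §1), as in every Theorems file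
set_option linter.dupNamespace false

namespace Summit.NavierStokesRegularity.NavierStokesRegularity.Theorems.LocalHelicityTubeDoorFrobeniusProfileRigiditySpaceTimeSpread

open MeasureTheory Set Function Filter Topology TopologicalSpace Metric InnerProductSpace
open scoped RealInnerProductSpace InnerProductSpace ContDiff
open Literature.Analysis Literature.Analysis.FluidPDE
open Summit.NavierStokesRegularity.NavierStokesRegularity.Theorems.LocalSineTubeDoorProfileAlignedWindowRigidityAncient
open Summit.NavierStokesRegularity.NavierStokesRegularity.Theorems.PoloidalWindowDoorPoloidalWindowRigidityWindow

variable {C : ℝ} {v : ℝ → EuclideanSpace ℝ (Fin 3) → EuclideanSpace ℝ (Fin 3)}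

/-! ### the slice derivative through the joint derivative -/

/-- **Chain rule for slices**: where `uncurry v` is differentiable, the derivative of the slice `v t` at `y` is the joint
derivative precomposed with the spatial injection, `D(v t)(y) = D(uncurry v)(t, y) ∘ (y' ↦ (0, y'))`. -/
theorem fderiv_slice_eq_comp {t : ℝ} {y : EuclideanSpace ℝ (Fin 3)}
    (hd : DifferentiableAt ℝ (uncurry v) (t, y)) :
    fderiv ℝ (v t) y = (fderiv ℝ (uncurry v) (t, y)).comp (ContinuousLinearMap.inr ℝ ℝ (EuclideanSpace ℝ (Fin 3))) := by
  have hι : HasFDerivAt (fun y' : EuclideanSpace ℝ (Fin 3) => ((t, y') : ℝ × EuclideanSpace ℝ (Fin 3)))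
      (ContinuousLinearMap.inr ℝ ℝ (EuclideanSpace ℝ (Fin 3))) y :=
    (hasFDerivAt_const t y).prodMk (hasFDerivAt_id y)
  have h3 : HasFDerivAt (uncurry v ∘ fun y' : EuclideanSpace ℝ (Fin 3) => ((t, y') : ℝ × EuclideanSpace ℝ (Fin 3)))
      ((fderiv ℝ (uncurry v) (t, y)).comp (ContinuousLinearMap.inr ℝ ℝ (EuclideanSpace ℝ (Fin 3)))) y :=
    hd.hasFDerivAt.comp y hι
  have h4 : (uncurry v ∘ fun y' : EuclideanSpace ℝ (Fin 3) => ((t, y') : ℝ × EuclideanSpace ℝ (Fin 3))) = v t := rfl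
  rw [h4] at h3
  exact h3.fderiv

/-- **The slice derivative `(t, y) ↦ D(v t)(y)` of an Oseen-ancient field is jointly real-analytic on the open slab.** -/
theorem analyticOnNhd_fderiv_slice_uncurry (hcont : ContinuousOn (uncurry v) (Iio (0 : ℝ) ×ˢ univ))
    (hbdd : ∀ δ : ℝ, 0 < δ → ∃ B : ℝ, ∀ t < -δ, ∀ y : EuclideanSpace ℝ (Fin 3), ‖v t y‖ ≤ B)
    (hmild : ∀ s t : ℝ, s < t → t < 0 → ∀ y : EuclideanSpace ℝ (Fin 3),
      v t y = UnboundedOperators.heatExtension (v s) (t - s) y - oseenDuhamel 1 s v v t y) :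
    AnalyticOnNhd ℝ (fun z : ℝ × EuclideanSpace ℝ (Fin 3) => fderiv ℝ (v z.1) z.2) (Iio (0 : ℝ) ×ˢ univ) := by
  have hA : AnalyticOnNhd ℝ (uncurry v) (Iio (0 : ℝ) ×ˢ univ) := analyticOnNhd_uncurry hcont hbdd hmild
  have hD : AnalyticOnNhd ℝ (fderiv ℝ (uncurry v)) (Iio (0 : ℝ) ×ˢ univ) := hA.fderiv
  have hO : IsOpen (Iio (0 : ℝ) ×ˢ (univ : Set (EuclideanSpace ℝ (Fin 3)))) := isOpen_Iio.prod isOpen_univ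
  -- precomposition with the spatial injection is a continuous linear operation
  set P : (ℝ × EuclideanSpace ℝ (Fin 3) →L[ℝ] EuclideanSpace ℝ (Fin 3)) →L[ℝ]
      (EuclideanSpace ℝ (Fin 3) →L[ℝ] EuclideanSpace ℝ (Fin 3)) :=
    (ContinuousLinearMap.compL ℝ (EuclideanSpace ℝ (Fin 3)) (ℝ × EuclideanSpace ℝ (Fin 3))
      (EuclideanSpace ℝ (Fin 3))).flip (ContinuousLinearMap.inr ℝ ℝ (EuclideanSpace ℝ (Fin 3))) with hP
  have hPD : AnalyticOnNhd ℝ (fun z => P (fderiv ℝ (uncurry v) z)) (Iio (0 : ℝ) ×ˢ univ) := P.comp_analyticOnNhd hD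
  refine fun z hz => (hPD z hz).congr ?_
  filter_upwards [hO.mem_nhds hz] with z' hz'
  have hd : DifferentiableAt ℝ (uncurry v) (z'.1, z'.2) := (hA z' hz').differentiableAt
  rw [fderiv_slice_eq_comp hd, hP]
  rfl

/-- **The vorticity `(t, y) ↦ curl v(t)(y)` of an Oseen-ancient field is jointly real-analytic on the open slab**
(`curl = curlCLM ∘ D`). -/
theorem analyticOnNhd_curl_uncurry (hcont : ContinuousOn (uncurry v) (Iio (0 : ℝ) ×ˢ univ))
    (hbdd : ∀ δ : ℝ, 0 < δ → ∃ B : ℝ, ∀ t < -δ, ∀ y : EuclideanSpace ℝ (Fin 3), ‖v t y‖ ≤ B)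
    (hmild : ∀ s t : ℝ, s < t → t < 0 → ∀ y : EuclideanSpace ℝ (Fin 3),
      v t y = UnboundedOperators.heatExtension (v s) (t - s) y - oseenDuhamel 1 s v v t y) :
    AnalyticOnNhd ℝ (uncurry fun t y => curl (v t) y) (Iio (0 : ℝ) ×ˢ univ) := by
  have heq : (uncurry fun t y => curl (v t) y) =
      (curlCLM : (EuclideanSpace ℝ (Fin 3) →L[ℝ] EuclideanSpace ℝ (Fin 3)) →L[ℝ] EuclideanSpace ℝ (Fin 3)) ∘
        (fun z : ℝ × EuclideanSpace ℝ (Fin 3) => fderiv ℝ (v z.1) z.2) := by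
    funext z
    rfl
  rw [heq]
  exact curlCLM.comp_analyticOnNhd (analyticOnNhd_fderiv_slice_uncurry hcont hbdd hmild)

/-- **The helicity density `(t, y) ↦ ⟪v(t,y), curl v(t)(y)⟫` of an Oseen-ancient field is jointly real-analytic on the
open slab.** -/
theorem analyticOnNhd_helicity_uncurry (hcont : ContinuousOn (uncurry v) (Iio (0 : ℝ) ×ˢ univ))
    (hbdd : ∀ δ : ℝ, 0 < δ → ∃ B : ℝ, ∀ t < -δ, ∀ y : EuclideanSpace ℝ (Fin 3), ‖v t y‖ ≤ B)
    (hmild : ∀ s t : ℝ, s < t → t < 0 → ∀ y : EuclideanSpace ℝ (Fin 3),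
      v t y = UnboundedOperators.heatExtension (v s) (t - s) y - oseenDuhamel 1 s v v t y) :
    AnalyticOnNhd ℝ (uncurry fun t y => ⟪v t y, curl (v t) y⟫_ℝ) (Iio (0 : ℝ) ×ˢ univ) := by
  have hA : AnalyticOnNhd ℝ (uncurry v) (Iio (0 : ℝ) ×ˢ univ) := analyticOnNhd_uncurry hcont hbdd hmild
  have hW := analyticOnNhd_curl_uncurry hcont hbdd hmild
  intro z hz
  exact ((innerSL ℝ (E := EuclideanSpace ℝ (Fin 3))).analyticAt_bilinear (uncurry v z, uncurry (fun t y =>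
    curl (v t) y) z)).comp₂ (hA z hz) (hW z hz)

/-! ### open set → slab and time segment → slab for the helicity density -/

/-- **Helicity-free on a nonempty open space-time set ⇒ helicity-free on the slab.**  For an Oseen-ancient field, if
`⟪v, curl v⟫` vanishes on a nonempty open subset `W` of the open slab `(−∞,0) × ℝ³`, it vanishes at every `s < 0`,
`y` (identity theorem for the jointly real-analytic helicity density on the connected slab). -/
theorem helicityOpenSetToSlab (hcont : ContinuousOn (uncurry v) (Iio (0 : ℝ) ×ˢ univ))
    (hbdd : ∀ δ : ℝ, 0 < δ → ∃ B : ℝ, ∀ t < -δ, ∀ y : EuclideanSpace ℝ (Fin 3), ‖v t y‖ ≤ B)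
    (hmild : ∀ s t : ℝ, s < t → t < 0 → ∀ y : EuclideanSpace ℝ (Fin 3),
      v t y = UnboundedOperators.heatExtension (v s) (t - s) y - oseenDuhamel 1 s v v t y)
    {W : Set (ℝ × EuclideanSpace ℝ (Fin 3))} (hWo : IsOpen W) (hWne : W.Nonempty)
    (hWsub : W ⊆ Iio (0 : ℝ) ×ˢ univ) (h0 : ∀ z ∈ W, ⟪v z.1 z.2, curl (v z.1) z.2⟫_ℝ = 0) :
    ∀ s < 0, ∀ y, ⟪v s y, curl (v s) y⟫_ℝ = 0 := by
  obtain ⟨z₀, hz₀⟩ := hWne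
  have hconv : Convex ℝ (Iio (0 : ℝ) ×ˢ (univ : Set (EuclideanSpace ℝ (Fin 3)))) :=
    (convex_Iio (0 : ℝ)).prod convex_univ
  have hpre : IsPreconnected (Iio (0 : ℝ) ×ˢ (univ : Set (EuclideanSpace ℝ (Fin 3)))) := hconv.isPreconnected
  set g : ℝ × EuclideanSpace ℝ (Fin 3) → ℝ := uncurry fun t y => ⟪v t y, curl (v t) y⟫_ℝ with hgdef
  have hg : AnalyticOnNhd ℝ g (Iio (0 : ℝ) ×ˢ univ) := analyticOnNhd_helicity_uncurry hcont hbdd hmild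
  have hev : g =ᶠ[𝓝 z₀] 0 := by
    filter_upwards [hWo.mem_nhds hz₀] with z hz
    rw [hgdef, Pi.zero_apply]
    exact h0 z hz
  have key : EqOn g 0 (Iio (0 : ℝ) ×ˢ univ) := hg.eqOn_zero_of_preconnected_of_eventuallyEq_zero hpre (hWsub hz₀) hev
  intro s hs y
  have hsy : ((s, y) : ℝ × EuclideanSpace ℝ (Fin 3)) ∈ Iio (0 : ℝ) ×ˢ (univ : Set (EuclideanSpace ℝ (Fin 3))) :=
    mem_prod.2 ⟨hs, mem_univ y⟩
  have h := key hsy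
  rw [hgdef, Pi.zero_apply] at h
  exact h

/-- **Helicity-free on a time segment ⇒ helicity-free on the slab**: if `⟪v s y, curl v(s)(y)⟫ = 0` for all
`s ∈ (s₁, s₂)` (`s₁ < s₂ ≤ 0`) and all `y`, then for all `s < 0` and all `y`.  So the hypothesis of K2⁗ may be
imposed on the far past only, or on a segment near the apex only. -/
theorem helicityTimeSegmentToSlab (hcont : ContinuousOn (uncurry v) (Iio (0 : ℝ) ×ˢ univ))
    (hbdd : ∀ δ : ℝ, 0 < δ → ∃ B : ℝ, ∀ t < -δ, ∀ y : EuclideanSpace ℝ (Fin 3), ‖v t y‖ ≤ B)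
    (hmild : ∀ s t : ℝ, s < t → t < 0 → ∀ y : EuclideanSpace ℝ (Fin 3),
      v t y = UnboundedOperators.heatExtension (v s) (t - s) y - oseenDuhamel 1 s v v t y)
    {s₁ s₂ : ℝ} (h12 : s₁ < s₂) (hs₂ : s₂ ≤ 0)
    (h0 : ∀ s ∈ Ioo s₁ s₂, ∀ y, ⟪v s y, curl (v s) y⟫_ℝ = 0) :
    ∀ s < 0, ∀ y, ⟪v s y, curl (v s) y⟫_ℝ = 0 := by
  refine helicityOpenSetToSlab hcont hbdd hmild (W := Ioo s₁ s₂ ×ˢ univ) (isOpen_Ioo.prod isOpen_univ)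
    ⟨((s₁ + s₂) / 2, 0), mem_prod.2 ⟨⟨by linarith, by linarith⟩, mem_univ _⟩⟩
    (prod_mono (fun s hs => lt_of_lt_of_le hs.2 hs₂) Subset.rfl) ?_
  rintro ⟨s, y⟩ hz
  exact h0 s (mem_prod.1 hz).1 y

/-- **The class form.**  For a profile of the Type-I class (rate, continuity, Oseen–Duhamel identity), helicity-free on
a nonempty open space-time subset of the slab ⇒ helicity-free on every slice. -/
theorem helicityOpenSetToSlab_of_class (hrate : HasTypeITimeDecay C v)
    (hcont : ContinuousOn (uncurry v) (Iio (0 : ℝ) ×ˢ univ))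
    (hmild : ∀ s t : ℝ, s < t → t < 0 → ∀ x,
      v t x = UnboundedOperators.heatExtension (v s) (t - s) x - oseenDuhamel 1 s v v t x)
    {W : Set (ℝ × EuclideanSpace ℝ (Fin 3))} (hWo : IsOpen W) (hWne : W.Nonempty)
    (hWsub : W ⊆ Iio (0 : ℝ) ×ˢ univ) (h0 : ∀ z ∈ W, ⟪v z.1 z.2, curl (v z.1) z.2⟫_ℝ = 0) :
    ∀ s < 0, ∀ y, ⟪v s y, curl (v s) y⟫_ℝ = 0 :=
  helicityOpenSetToSlab hcont (bdd_of_hasTypeITimeDecay hrate) hmild hWo hWne hWsub h0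

/-- **Liouville(𝔉) is equivalent to its open-set version**: «every profile of the Type-I class that is helicity-free
on EVERY slice vanishes» ⇔ «every profile of the class that is helicity-free on SOME nonempty open space-time subset
of the slab vanishes» (→: `helicityOpenSetToSlab_of_class`; ←: the slab itself is such a set). -/
theorem frobeniusLiouville_iff_openSet :
    (∀ (C : ℝ) (v : ℝ → EuclideanSpace ℝ (Fin 3) → EuclideanSpace ℝ (Fin 3)),
      (Literature.Analysis.FluidPDE.HasTypeITimeDecay C v ∧
        ContinuousOn (Function.uncurry v) (Set.Iio (0 : ℝ) ×ˢ Set.univ) ∧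
        (∀ s t : ℝ, s < t → t < 0 → ∀ x, v t x =
          Literature.Analysis.UnboundedOperators.heatExtension (v s) (t - s) x -
            Literature.Analysis.FluidPDE.oseenDuhamel 1 s v v t x) ∧
        (∀ t < 0, Literature.Analysis.FluidPDE.VectorCalculus.IsDivFree (v t)) ∧
        (∀ s < 0, ∀ y : EuclideanSpace ℝ (Fin 3),
          inner ℝ (v s y) (Literature.Analysis.FluidPDE.curl (v s) y) = 0)) →
      ∀ t < 0, ∀ x, v t x = 0) ↔
    (∀ (C : ℝ) (v : ℝ → EuclideanSpace ℝ (Fin 3) → EuclideanSpace ℝ (Fin 3)),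
      (Literature.Analysis.FluidPDE.HasTypeITimeDecay C v ∧
        ContinuousOn (Function.uncurry v) (Set.Iio (0 : ℝ) ×ˢ Set.univ) ∧
        (∀ s t : ℝ, s < t → t < 0 → ∀ x, v t x =
          Literature.Analysis.UnboundedOperators.heatExtension (v s) (t - s) x -
            Literature.Analysis.FluidPDE.oseenDuhamel 1 s v v t x) ∧
        (∀ t < 0, Literature.Analysis.FluidPDE.VectorCalculus.IsDivFree (v t)) ∧
        (∃ W : Set (ℝ × EuclideanSpace ℝ (Fin 3)), IsOpen W ∧ W.Nonempty ∧ W ⊆ Set.Iio (0 : ℝ) ×ˢ Set.univ ∧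
          ∀ z ∈ W, inner ℝ (v z.1 z.2) (Literature.Analysis.FluidPDE.curl (v z.1) z.2) = 0)) →
      ∀ t < 0, ∀ x, v t x = 0) := by
  constructor
  · rintro h C v ⟨hrate, hcont, hmild, hdiv, W, hWo, hWne, hWsub, h0⟩
    exact h C v ⟨hrate, hcont, hmild, hdiv, helicityOpenSetToSlab_of_class hrate hcont hmild hWo hWne hWsub h0⟩
  · rintro h C v ⟨hrate, hcont, hmild, hdiv, hhel⟩
    refine h C v ⟨hrate, hcont, hmild, hdiv, Iio 0 ×ˢ univ, isOpen_Iio.prod isOpen_univ,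
      ⟨(-1, 0), mem_prod.2 ⟨by norm_num, mem_univ _⟩⟩, Subset.rfl, ?_⟩
    rintro ⟨s, y⟩ hz
    exact hhel s (mem_prod.1 hz).1 y

end Summit.NavierStokesRegularity.NavierStokesRegularity.Theorems.LocalHelicityTubeDoorFrobeniusProfileRigiditySpaceTimeSpread

end
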